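import Summits.HodgeConjecture.HodgeConjecture.Theses.NikulinTwinTransport

/-!
# Sketch — crux-ideate r1 k1, crux `TwinTransportRMPicardTwo` (stmt-HodgeConjecture-15067)

First lemmas of the two idea cards of this seat:

* `dihedral-hecke-octagon` —
  - `hecke_sq_eq_two` : the representation-theoretic heart of the dihedral lever: on a module
    where an invertible operator `s` satisfies `s⁴ = −1` (the PRIMITIVE constituent `W₈` of a
    `D₈`-module), the Hecke operator `e := s + s⁻¹` satisfies `e² = 2` — real multiplication
    by `√2 = ζ₈ + ζ₈⁻¹`.
  - `SelfAnchorRMPicardTwo` / `crux_of_selfAnchor` : the typed CLOSING MOVE of the line.  The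
    dihedral Hecke correspondence lives on `S × S` (no twin), so the line delivers the crux
    through the SELF-anchor `S″ = S`, `p″ = p` (allowed: `rk T(S) = 20` is even, honouring
    `Negative.no_self_twoSimilitude_of_odd`).  `SelfAnchorRMPicardTwo` is the crux conclusion
    with `S″ := S` VERBATIM over the route's carriers; `crux_of_selfAnchor` is the (trivial,
    kernel-checked) implication to the route decl BY NAME.
* `rm-eigen-twistor` —
  - `selfAdjoint_scalar_on_preserves_perp` : automatic `SU(2)`-invariance, linear-algebra
    shadow: a self-adjoint operator that is a scalar on the positive 3-plane `P` preserves
    `P^⊥`; with `A = ẽ = e ⊕ ν` (`√2` on the eigenspace `V₊ ⊃ P`) this is Verbitsky's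
    invariance condition for the mixed class `ẽ ∈ H² ⊗ H²` on `S × S` with ONE product
    hyperkähler metric.
-/

set_option linter.dupNamespace false
set_option linter.unusedVariables false

namespace Summit.HodgeConjecture.HodgeConjecture.Cruxes.TwinTransportRMPicardTwo.IdeatorR1K1

open scoped BigOperators Manifold

section Hecke

variable {R M : Type*} [CommRing R] [AddCommGroup M] [Module R M]

/-- **Dihedral Hecke identity.** If `s` is invertible with `s (s (s (s x))) = -x` (i.e. the
module is the primitive constituent of a `ℤ/8`-action), then `e = s + s⁻¹` has `e (e x) = 2x`.
[folklore; van Geemen–Schütt arXiv:2310.05196 §4.7–4.8 for odd prime order] -/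
theorem hecke_sq_eq_two (s : M ≃ₗ[R] M) (hs : ∀ x : M, s (s (s (s x))) = -x) (x : M) :
    (s.toLinearMap + s.symm.toLinearMap) ((s.toLinearMap + s.symm.toLinearMap) x)
      = (2 : R) • x := by
  -- s⁻² = -s² on the module: apply `hs` to `s⁻¹ (s⁻¹ x)`
  have key : s.symm (s.symm x) = -(s (s x)) := by
    have h := hs (s.symm (s.symm x))
    simp only [LinearEquiv.apply_symm_apply] at h
    -- h : s (s x) = -(s.symm (s.symm x))  (after simplification of s s s s s⁻¹ s⁻¹ x)
    rw [h, neg_neg]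
  simp only [LinearMap.add_apply, LinearEquiv.coe_coe, map_add, LinearEquiv.apply_symm_apply,
    LinearEquiv.symm_apply_apply, key, two_smul]
  abel

end Hecke

section Invariance

variable {V : Type*} [AddCommGroup V] [Module ℝ V]

/-- **Automatic SU(2)-invariance (shadow).** For a symmetric bilinear form `B`, a `B`-self-adjoint
operator `A` which acts on a subspace `P` as the scalar `c` maps `P^⊥` into `P^⊥`.  Applied to
`A = ẽ = e ⊕ ν` (self-adjoint, `= √2` on the eigenspace `V₊ ⊇ P`, `P` the positive 3-plane of a
product hyperkähler structure), `ẽ ∈ ℝ·id_P ⊕ End(P^⊥)` is `SO(3) = SU(2)/±1`-invariant in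
`H² ⊗ H²`. [folklore] -/
theorem selfAdjoint_scalar_on_preserves_perp (B : V →ₗ[ℝ] V →ₗ[ℝ] ℝ)
    (hB : ∀ x y, B x y = B y x) (A : V →ₗ[ℝ] V) (hA : ∀ x y, B (A x) y = B x (A y))
    (P : Submodule ℝ V) (c : ℝ) (hP : ∀ p ∈ P, A p = c • p) {v : V}
    (hv : ∀ p ∈ P, B v p = 0) : ∀ p ∈ P, B (A v) p = 0 := by
  intro p hp
  rw [hA, hP p hp, map_smul, smul_eq_mul, hv p hp, mul_zero]

end Invariance

section ClosingMove

open Literature.AlgebraicGeometry.HodgeTheory Literature.AlgebraicGeometry.Motives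
  Literature.AlgebraicTopology.SingularHomology CategoryTheory

/-- **Self-anchor form of the crux** (`S″ := S`, `p″ := p`): for every Picard-rank-2 projective K3
surface `S` with a rational type-preserving `e` killing `NS` and squaring to `2` on `NS^⊥`, there is
an ALGEBRAIC `Ψ : H²(S) ≃ H²(S)` (`Ψ = [γ]_*`, `γ ∈ algebraicClasses (S ⊗ S) 2`) whose inverse is
rational, type-preserving and halves the cup form.  This is what the dihedral line delivers:
`Ψ := [rC + Z_ν + …]_*` with `C` the octagon-neighbour correspondence. -/
def SelfAnchorRMPicardTwo : Prop :=
  ∀ (μ : OrientationFamily), μ.HasPoincareDuality → ∀ (S : SchemeOver ℂ)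
    (hS : (IsSmoothProjective 2 S ∧ Subsingleton (structureSheafCohomology S.left 1) ∧
      ∃ (A : HodgeModel 2 S) (η : Literature.Geometry.Kaehler.MForm 𝓘(ℝ, A.model) A.carrier ℂ 2),
        Literature.Geometry.Kaehler.IsHolomorphicInCharts η ∧ ∀ x, η x ≠ 0))
    (p : complexBetti S (2 * 2)),
    (IsIntegralClass p ∧ ∀ q : complexBetti S (2 * 2), IsIntegralClass q → ∃ n : ℤ, q = n • p) →
    Module.finrank ℂ ↥(algebraicClasses S 1) = 2 →
    ∀ (e : complexBetti S (2 * 1) →ₗ[ℂ] complexBetti S (2 * 1)),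
    (∀ x, IsRationalClass x → IsRationalClass (e x)) →
    (∀ (i j : ℕ) x, IsOfHodgeType 2 S (2 * 1) i j x → IsOfHodgeType 2 S (2 * 1) i j (e x)) →
    (∀ d ∈ algebraicClasses S 1, e d = 0) →
    (∀ x : complexBetti S (2 * 1), (∀ d ∈ algebraicClasses S 1,
      cupProduct (rfl : 2 * 1 + 2 * 1 = 2 * 2) x d = 0) → e (e x) = (2 : ℂ) • x) →
    ∃ Ψ : complexBetti S (2 * 1) ≃ₗ[ℂ] complexBetti S (2 * 1),
      (∀ y, IsRationalClass y → IsRationalClass (Ψ.symm y)) ∧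
      (∀ (i j : ℕ) y, IsOfHodgeType 2 S (2 * 1) i j y → IsOfHodgeType 2 S (2 * 1) i j (Ψ.symm y)) ∧
      (∀ (u v : complexBetti S (2 * 1)) (b : ℂ),
        cupProduct (rfl : 2 * 1 + 2 * 1 = 2 * 2) u v = ((2 : ℂ) * b) • p →
        cupProduct (rfl : 2 * 1 + 2 * 1 = 2 * 2) (Ψ.symm u) (Ψ.symm v) = b • p) ∧
      ∃ γ ∈ algebraicClasses (MonoidalCategoryStruct.tensorObj S S) 2,
        ∀ x : complexBetti S (2 * 1), Ψ x =
          complexGysin μ (IsSmoothProjective.tensor_holds hS.1 hS.1) hS.1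
            (SemiCartesianMonoidalCategory.fst S S) (rfl : 2 * 1 + 2 * 2 + 2 * 2 = 2 * 1 + 2 * (2 + 2))
            (cupProduct (rfl : 2 * 1 + 2 * 2 = 2 * 1 + 2 * 2)
              (complexBetti.map (SemiCartesianMonoidalCategory.snd S S) (2 * 1) x) γ)

/-- **Closing move, kernel-checked.** The self-anchor form implies the route crux BY NAME
(`S″ := S`, `hS″ := hS`, `p″ := p`). -/
theorem crux_of_selfAnchor (h : SelfAnchorRMPicardTwo) :
    Summit.HodgeConjecture.HodgeConjecture.Theses.NikulinTwinTransport.TwinTransportRMPicardTwo := by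
  intro μ hμ S hS p hp hρ e he₁ he₂ he₃ he₄
  obtain ⟨Ψ, h₁, h₂, h₃, h₄⟩ := h μ hμ S hS p hp hρ e he₁ he₂ he₃ he₄
  exact ⟨S, hS, p, ⟨hp, Ψ, h₁, h₂, h₃, h₄⟩⟩

end ClosingMove

end Summit.HodgeConjecture.HodgeConjecture.Cruxes.TwinTransportRMPicardTwo.IdeatorR1K1
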